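import Summits.Parity.GeneralizedHardyLittlewood.Theorems.LeeYangFibresFibrationLemmaDisc
import HarnessLib

/-!
# Fibration lemma (`DimOne → GeneralizedHardyLittlewood`), part 4: the minimal fibre factor at a prime

Support file for the statement item `FibrationLemma : DimOne → GeneralizedHardyLittlewood`
(Green–Tao 2010, §1, remark after Conj. 1.2). For a system `Ψ` on `ℤ^{d+1}` fibred over its first
`d` coordinates and a *large* prime `p` (`p > 2L²`, `p > t`, so `p ∤ aᵢ` and every non-parallel
discriminant form is non-constant mod `p`), the local factors `β_p(Φ_w)` of the fibre systems take
their minimum `m_p` (`minFactor`) at every *generic* base point `w` — one at which no NON-PARALLEL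
discriminant `Dᵢⱼ(w)` is divisible by `p` (`genericSet`): the coincidences of roots at a generic point
are exactly those forced by the parallel pairs, which occur at every base point
(`localFactor_eq_minFactor_of_mem_genericSet`, from the monotonicity `localFactor_dimOne_mono`).
Non-generic points are rare (`card_not_mem_genericSet_le`: at most `t² p^{d-1}` residues mod `p`) and there
`β_p(Φ_w) ≤ m_p (p-1)/(p-t)` (`localFactor_le_minFactor_mul`). Averaging (`β_p(Ψ) = 𝔼_w β_p(Φ_w)`,
part 1) gives the factorisation used for the tail of the singular products:

  `m_p ≤ β_p(Ψ) ≤ m_p (1 + t³/(p (p - t)))`                    (`minFactor_le_localFactor`,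
                                                                  `localFactor_le_minFactor_mul_add`).
-/

noncomputable section

open Finset

namespace Summit.Parity.GeneralizedHardyLittlewood.Theorems

open Literature.NumberTheory.Sieve

variable {d t : ℕ}

/-! ### Large primes: the casts that do not vanish -/

/-- The coefficient bound `|ψ̇ᵢ(e_j)| ≤ L` together with `aᵢ ≠ 0` forces `1 ≤ L`. [folklore] -/
theorem one_le_of_coeff_bound {Ψ : Fin t → AffLinForm (d + 1)} {L : ℕ}
    (hL : ∀ i j, ((Ψ i).coeff j).natAbs ≤ L) (ha : ∀ i, lastCoeff (Ψ i) ≠ 0) (ht : 1 ≤ t) : 1 ≤ L := by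
  have h := hL ⟨0, ht⟩ (Fin.last d)
  have h0 : lastCoeff (Ψ ⟨0, ht⟩) ≠ 0 := ha _
  rw [lastCoeff] at h0
  have : 0 < ((Ψ ⟨0, ht⟩).coeff (Fin.last d)).natAbs := Int.natAbs_pos.mpr h0
  omega

/-- For a prime `p > L ≥ |aᵢ|`, `aᵢ ≠ 0`: the fibre coefficient of `Φ_w` is a unit mod `p`. [folklore] -/
theorem fibreCoeff_cast_ne_zero {Ψ : Fin t → AffLinForm (d + 1)} {L : ℕ}
    (hL : ∀ i j, ((Ψ i).coeff j).natAbs ≤ L) (ha : ∀ i, lastCoeff (Ψ i) ≠ 0) {p : ℕ} (hp : L < p)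
    (w : Fin d → ℤ) (i : Fin t) : (((fibreSystem Ψ w i).coeff 0 : ℤ) : ZMod p) ≠ 0 := by
  rw [show (fibreSystem Ψ w i).coeff 0 = lastCoeff (Ψ i) from fibreForm_coeff _ _ _]
  exact intCast_zmod_ne_zero_of_natAbs_lt (ha i) ((hL i (Fin.last d)).trans_lt hp)

/-- The coefficients of the discriminant forms are bounded by `2L²`. [folklore] -/
theorem natAbs_discForm_coeff_le {Ψ : Fin t → AffLinForm (d + 1)} {L : ℕ}
    (hL : ∀ i j, ((Ψ i).coeff j).natAbs ≤ L) (i j : Fin t) (k : Fin d) :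
    ((discForm Ψ i j).coeff k).natAbs ≤ 2 * L * L := by
  simp only [discForm, lastCoeff]
  calc ((Ψ i).coeff (Fin.last d) * (Ψ j).coeff k.castSucc - (Ψ j).coeff (Fin.last d) * (Ψ i).coeff k.castSucc).natAbs
      ≤ ((Ψ i).coeff (Fin.last d) * (Ψ j).coeff k.castSucc).natAbs +
          ((Ψ j).coeff (Fin.last d) * (Ψ i).coeff k.castSucc).natAbs := Int.natAbs_sub_le _ _
    _ ≤ L * L + L * L := by
        rw [Int.natAbs_mul, Int.natAbs_mul]
        exact add_le_add (Nat.mul_le_mul (hL _ _) (hL _ _)) (Nat.mul_le_mul (hL _ _) (hL _ _))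
    _ = 2 * L * L := by ring

/-! ### Generic base points -/

/-- The set of base points `w` that are *generic* at `p`: no non-parallel discriminant `Dᵢⱼ(w)`
(`i ≠ j`, `Ḋᵢⱼ ≠ 0`) is divisible by `p`. [cite: GreenTao2010, §1 (remark after Conj. 1.2)] -/
def genericSet (Ψ : Fin t → AffLinForm (d + 1)) (p : ℕ) : Set (Fin d → ℤ) :=
  {w | ∀ i j, i ≠ j → (discForm Ψ i j).coeff ≠ 0 → ¬ (p : ℤ) ∣ (discForm Ψ i j).eval w}

/-- Unfolding genericity. [folklore] -/
theorem mem_genericSet {Ψ : Fin t → AffLinForm (d + 1)} {p : ℕ} {w : Fin d → ℤ} :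
    w ∈ genericSet Ψ p ↔ ∀ i j, i ≠ j → (discForm Ψ i j).coeff ≠ 0 → ¬ (p : ℤ) ∣ (discForm Ψ i j).eval w :=
  Iff.rfl

/-- At a generic point the root coincidences are contained in those of any other base point: a
coincidence `p ∣ Dᵢⱼ(w)` can only come from a parallel pair, whose discriminant is constant in `w`.
[cite: GreenTao2010, proof of Lemma 1.3] -/
theorem dvd_disc_of_mem_genericSet {Ψ : Fin t → AffLinForm (d + 1)} {p : ℕ} {w : Fin d → ℤ}
    (hw : w ∈ genericSet Ψ p) (w' : Fin d → ℤ) (i j : Fin t)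
    (h : (p : ℤ) ∣ disc (fibreSystem Ψ w) i j) : (p : ℤ) ∣ disc (fibreSystem Ψ w') i j := by
  rw [disc_fibreSystem] at h ⊢
  by_cases hij : i = j
  · subst hij
    rw [← disc_fibreSystem, disc_self]
    exact dvd_zero _
  · by_cases hc : (discForm Ψ i j).coeff = 0
    · -- parallel pair: `Dᵢⱼ` is constant
      have : (discForm Ψ i j).eval w' = (discForm Ψ i j).eval w := by
        simp only [AffLinForm.eval, hc, Pi.zero_apply, zero_mul, Finset.sum_const_zero, zero_add]
      rwa [this]
    · exact absurd h (mem_genericSet.mp hw i j hij hc)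

/-! ### The minimal fibre factor -/

/-- The local factor of the fibre system over a base residue (as a natural-number vector).
[cite: GreenTao2010, (1.6)] -/
def fibreFactorNat (Ψ : Fin t → AffLinForm (d + 1)) (p : ℕ) (w : Fin d → ℕ) : ℝ :=
  localFactor (fibreSystem Ψ fun j => (w j : ℤ)) p

/-- A base point in `{0, …, p-1}^d` at which `β_p(Φ_w)` is minimal (junk `0` if `p = 0`).
[cite: GreenTao2010, §1 (remark after Conj. 1.2)] -/
def minPoint (Ψ : Fin t → AffLinForm (d + 1)) (p : ℕ) : Fin d → ℤ :=
  if h : (Fintype.piFinset fun _ : Fin d => range p).Nonempty then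
    fun j => ((Classical.choose (Finset.exists_min_image _ (fibreFactorNat Ψ p) h)) j : ℤ)
  else 0

/-- The minimal fibre factor `m_p = min_w β_p(Φ_w)`. [cite: GreenTao2010, §1 (remark after Conj. 1.2)] -/
def minFactor (Ψ : Fin t → AffLinForm (d + 1)) (p : ℕ) : ℝ :=
  localFactor (fibreSystem Ψ (minPoint Ψ p)) p

/-- `m_p ≤ β_p(Φ_w)` for every residue vector `w ∈ {0,…,p-1}^d`. [folklore] -/
theorem minFactor_le_fibreFactorNat (Ψ : Fin t → AffLinForm (d + 1)) {p : ℕ} {w : Fin d → ℕ}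
    (hw : w ∈ Fintype.piFinset fun _ : Fin d => range p) : minFactor Ψ p ≤ fibreFactorNat Ψ p w := by
  have hne : (Fintype.piFinset fun _ : Fin d => range p).Nonempty := ⟨w, hw⟩
  have hspec := Classical.choose_spec (Finset.exists_min_image _ (fibreFactorNat Ψ p) hne)
  unfold minFactor minPoint
  rw [dif_pos hne]
  exact hspec.2 w hw

/-- **`m_p ≤ β_p(Φ_w)` for every base point `w ∈ ℤ^d`** (reduce `w` mod `p` and use periodicity).
[cite: GreenTao2010, (1.6)] -/
theorem minFactor_le (Ψ : Fin t → AffLinForm (d + 1)) {p : ℕ} [NeZero p] (w : Fin d → ℤ) :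
    minFactor Ψ p ≤ localFactor (fibreSystem Ψ w) p := by
  set w' : Fin d → ℕ := fun j => (w j % p).toNat with hw'
  have hp0 : (0 : ℤ) < p := by exact_mod_cast Nat.pos_of_ne_zero (NeZero.ne p)
  have hmem : w' ∈ Fintype.piFinset fun _ : Fin d => range p := by
    refine Fintype.mem_piFinset.mpr fun j => Finset.mem_range.mpr ?_
    have h1 : 0 ≤ w j % p := Int.emod_nonneg _ hp0.ne'
    have h2 : w j % p < p := Int.emod_lt_of_pos _ hp0
    zify
    rw [hw', Int.toNat_of_nonneg h1]
    exact h2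
  have hcongr : ∀ j, (((fun j => (w' j : ℤ)) j : ℤ) : ZMod p) = ((w j : ℤ) : ZMod p) := by
    intro j
    have h1 : 0 ≤ w j % p := Int.emod_nonneg _ hp0.ne'
    simp only [hw', Int.natCast_toNat_eq_self.mpr h1]
    exact ZMod.intCast_mod _ _
  calc minFactor Ψ p ≤ fibreFactorNat Ψ p w' := minFactor_le_fibreFactorNat Ψ hmem
    _ = localFactor (fibreSystem Ψ w) p := localFactor_fibreSystem_congr Ψ hcongr

section LargePrime

variable {Ψ : Fin t → AffLinForm (d + 1)} {L : ℕ} {p : ℕ} [hp : Fact p.Prime]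

/-- `m_p > 0` for a large prime. [folklore] -/
theorem minFactor_pos (hL : ∀ i j, ((Ψ i).coeff j).natAbs ≤ L) (ha : ∀ i, lastCoeff (Ψ i) ≠ 0)
    (hpL : L < p) (hpt : t < p) : 0 < minFactor Ψ p :=
  localFactor_dimOne_pos _ (fibreCoeff_cast_ne_zero hL ha hpL _) hpt

/-- **At a generic base point the fibre factor is minimal**: `β_p(Φ_w) = m_p`.
[cite: GreenTao2010, proof of Lemma 1.3] -/
theorem localFactor_eq_minFactor_of_mem_genericSet (hL : ∀ i j, ((Ψ i).coeff j).natAbs ≤ L)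
    (ha : ∀ i, lastCoeff (Ψ i) ≠ 0) (hpL : L < p) {w : Fin d → ℤ} (hw : w ∈ genericSet Ψ p) :
    localFactor (fibreSystem Ψ w) p = minFactor Ψ p := by
  refine le_antisymm ?_ (minFactor_le Ψ w)
  unfold minFactor
  exact localFactor_dimOne_mono _ _ (fibreCoeff_cast_ne_zero hL ha hpL _)
    (fibreCoeff_cast_ne_zero hL ha hpL _) (fun i j h => dvd_disc_of_mem_genericSet hw _ i j h)

/-- At any base point, `β_p(Φ_w) ≤ m_p · (p-1)/(p-t)` (`β_p(Φ_w) ≤ (p/(p-1))^{t-1}` and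
`m_p ≥ (p/(p-1))^t (p-t)/p`). [folklore] -/
theorem localFactor_le_minFactor_mul (hL : ∀ i j, ((Ψ i).coeff j).natAbs ≤ L)
    (ha : ∀ i, lastCoeff (Ψ i) ≠ 0) (hpL : L < p) (hpt : t < p) (ht : 1 ≤ t) (w : Fin d → ℤ) :
    localFactor (fibreSystem Ψ w) p ≤ minFactor Ψ p * (((p : ℝ) - 1) / ((p : ℝ) - t)) := by
  have hp1 : (1 : ℝ) < p := by exact_mod_cast hp.out.one_lt
  have hpt' : (t : ℝ) < p := by exact_mod_cast hpt
  have hq : (0 : ℝ) < (p : ℝ) / (p - 1) := div_pos (by linarith) (by linarith)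
  have h1 := localFactor_dimOne_le_pow_pred (fibreSystem Ψ w) (fibreCoeff_cast_ne_zero hL ha hpL _) ht
  have h2 : ((p : ℝ) / (p - 1)) ^ t * (((p : ℝ) - t) / p) ≤ minFactor Ψ p :=
    localFactor_dimOne_ge _ (fibreCoeff_cast_ne_zero hL ha hpL _)
  -- `(p/(p-1))^{t-1} = (p/(p-1))^t (p-t)/p · (p-1)/(p-t)`
  have hX : ((p : ℝ) / (p - 1)) ^ t = ((p : ℝ) / (p - 1)) ^ (t - 1) * ((p : ℝ) / (p - 1)) := by
    conv_lhs => rw [← Nat.sub_add_cancel ht, pow_succ]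
  have hne : ((p : ℝ) - 1) * ((p : ℝ) * ((p : ℝ) - t)) ≠ 0 :=
    mul_ne_zero (by linarith) (mul_ne_zero (by linarith) (by linarith))
  have h3 : ((p : ℝ) / (p - 1)) * ((((p : ℝ) - t) / p) * (((p : ℝ) - 1) / ((p : ℝ) - t))) = 1 := by
    rw [div_mul_div_comm, div_mul_div_comm, div_eq_one_iff_eq hne]
    ring
  have heq : ((p : ℝ) / (p - 1)) ^ (t - 1) =
      ((p : ℝ) / (p - 1)) ^ t * (((p : ℝ) - t) / p) * (((p : ℝ) - 1) / ((p : ℝ) - t)) := by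
    rw [hX, mul_assoc, mul_assoc, h3, mul_one]
  calc localFactor (fibreSystem Ψ w) p ≤ ((p : ℝ) / (p - 1)) ^ (t - 1) := h1
    _ = ((p : ℝ) / (p - 1)) ^ t * (((p : ℝ) - t) / p) * (((p : ℝ) - 1) / ((p : ℝ) - t)) := heq
    _ ≤ minFactor Ψ p * (((p : ℝ) - 1) / ((p : ℝ) - t)) :=
        mul_le_mul_of_nonneg_right h2 (div_nonneg (by linarith) (by linarith))

/-! ### Few non-generic residues -/

/-- A non-parallel discriminant form has a coefficient that is a unit mod a large prime. [folklore] -/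
theorem exists_discForm_coeff_cast_ne_zero (hL : ∀ i j, ((Ψ i).coeff j).natAbs ≤ L)
    (hpL : 2 * L * L < p) {i j : Fin t} (hc : (discForm Ψ i j).coeff ≠ 0) :
    ∃ k, (((discForm Ψ i j).coeff k : ℤ) : ZMod p) ≠ 0 := by
  obtain ⟨k, hk⟩ : ∃ k, (discForm Ψ i j).coeff k ≠ 0 := by
    by_contra h
    push Not at h
    exact hc (funext h)
  exact ⟨k, intCast_zmod_ne_zero_of_natAbs_lt hk ((natAbs_discForm_coeff_le hL i j k).trans_lt hpL)⟩

/-- For a non-parallel pair, `p ∣ Dᵢⱼ(w)` for exactly `p^{d-1}` residues `w mod p`; we record `≤`.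
[cite: GreenTao2010, proof of Lemma 1.3] -/
theorem card_filter_dvd_discForm_le (hL : ∀ i j, ((Ψ i).coeff j).natAbs ≤ L) (hpL : 2 * L * L < p)
    {i j : Fin t} (hc : (discForm Ψ i j).coeff ≠ 0) :
    #{w ∈ Fintype.piFinset (fun _ : Fin d => range p) |
        (p : ℤ) ∣ (discForm Ψ i j).eval fun k => (w k : ℤ)} ≤ p ^ (d - 1) := by
  classical
  obtain ⟨k, hk⟩ := exists_discForm_coeff_cast_ne_zero hL hpL hc
  -- pass to `(ℤ/p)^d`
  have hcard : #{w ∈ Fintype.piFinset (fun _ : Fin d => range p) |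
      (p : ℤ) ∣ (discForm Ψ i j).eval fun k => (w k : ℤ)} =
        #{v : Fin d → ZMod p | (discForm Ψ i j).modEval p v = 0} := by
    rw [Finset.card_filter, Finset.card_filter]
    have := sum_piFinset_range_eq_sum_zmod (d := d) p
      (fun v => if (discForm Ψ i j).modEval p v = 0 then 1 else 0)
    refine Eq.trans (Finset.sum_congr rfl fun w _ => ?_) this
    congr 1
    rw [← ZMod.intCast_zmod_eq_zero_iff_dvd, AffLinForm.intCast_eval]
    simp only [Int.cast_natCast]
  rw [hcard]
  have hmul := card_modZero_mul (discForm Ψ i j) (fun h => hk (congr_fun h k))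
  have hp0 : 0 < p := hp.out.pos
  rcases Nat.eq_zero_or_pos d with hd | hd
  · subst hd
    simp only [pow_zero, Nat.zero_sub] at hmul ⊢
    have : #{v : Fin 0 → ZMod p | (discForm Ψ i j).modEval p v = 0} ≤ 1 :=
      (Finset.card_le_univ _).trans (by simp)
    exact this
  · have : p ^ d = p ^ (d - 1) * p := by rw [← pow_succ, Nat.sub_add_cancel hd]
    rw [this] at hmul
    exact le_of_eq (Nat.eq_of_mul_eq_mul_right hp0 hmul)

open Classical in
/-- **Non-generic residues are rare**: at most `t² p^{d-1}` of the `p^d` residues `w mod p` are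
non-generic. [cite: GreenTao2010, proof of Lemma 1.3] -/
theorem card_not_mem_genericSet_le (hL : ∀ i j, ((Ψ i).coeff j).natAbs ≤ L) (hpL : 2 * L * L < p) :
    #{w ∈ Fintype.piFinset (fun _ : Fin d => range p) | ¬ (fun k => (w k : ℤ)) ∈ genericSet Ψ p} ≤
      t * t * p ^ (d - 1) := by
  classical
  have hsub : ({w ∈ Fintype.piFinset (fun _ : Fin d => range p) | ¬ (fun k => (w k : ℤ)) ∈ genericSet Ψ p} : Finset _)
      ⊆ (((univ : Finset (Fin t)).offDiag).filter fun ij => (discForm Ψ ij.1 ij.2).coeff ≠ 0).biUnion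
        fun ij => {w ∈ Fintype.piFinset (fun _ : Fin d => range p) |
          (p : ℤ) ∣ (discForm Ψ ij.1 ij.2).eval fun k => (w k : ℤ)} := by
    intro w hw
    obtain ⟨hbox, hng⟩ := Finset.mem_filter.mp hw
    rw [mem_genericSet] at hng
    push Not at hng
    obtain ⟨i, j, hij, hc, hdvd⟩ := hng
    exact Finset.mem_biUnion.mpr ⟨(i, j), Finset.mem_filter.mpr
      ⟨Finset.mem_offDiag.mpr ⟨Finset.mem_univ _, Finset.mem_univ _, hij⟩, hc⟩,
      Finset.mem_filter.mpr ⟨hbox, hdvd⟩⟩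
  calc _ ≤ _ := Finset.card_le_card hsub
    _ ≤ ∑ ij ∈ ((univ : Finset (Fin t)).offDiag).filter fun ij => (discForm Ψ ij.1 ij.2).coeff ≠ 0,
          #{w ∈ Fintype.piFinset (fun _ : Fin d => range p) |
            (p : ℤ) ∣ (discForm Ψ ij.1 ij.2).eval fun k => (w k : ℤ)} := Finset.card_biUnion_le
    _ ≤ ∑ _ij ∈ ((univ : Finset (Fin t)).offDiag).filter fun ij => (discForm Ψ ij.1 ij.2).coeff ≠ 0,
          p ^ (d - 1) :=
        Finset.sum_le_sum fun ij hij => card_filter_dvd_discForm_le hL hpL (Finset.mem_filter.mp hij).2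
    _ ≤ t * t * p ^ (d - 1) := by
        rw [Finset.sum_const, smul_eq_mul]
        refine Nat.mul_le_mul_right _ ?_
        calc _ ≤ #((univ : Finset (Fin t)).offDiag) := Finset.card_filter_le _ _
          _ = t * t - t := by rw [Finset.offDiag_card, Finset.card_univ, Fintype.card_fin]
          _ ≤ t * t := Nat.sub_le _ _

/-! ### The factorisation `m_p ≤ β_p(Ψ) ≤ m_p (1 + t³/(p(p-t)))` -/

/-- `m_p ≤ β_p(Ψ)` (the average is at least the minimum). [cite: GreenTao2010, (1.6)] -/
theorem minFactor_le_localFactor (Ψ : Fin t → AffLinForm (d + 1)) :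
    minFactor Ψ p ≤ localFactor Ψ p := by
  have hp0 : (0 : ℝ) < p := by exact_mod_cast hp.out.pos
  have hcard : #(Fintype.piFinset fun _ : Fin d => range p) = p ^ d := by
    rw [Fintype.card_piFinset, Finset.prod_const, Finset.card_range, Finset.card_univ, Fintype.card_fin]
  rw [localFactor_eq_avg_fibre Ψ hp.out.ne_zero]
  calc minFactor Ψ p = ((p : ℝ) ^ d)⁻¹ * ∑ _w ∈ Fintype.piFinset (fun _ : Fin d => range p), minFactor Ψ p := by
        rw [Finset.sum_const, hcard, nsmul_eq_mul]
        push_cast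
        rw [← mul_assoc, inv_mul_cancel₀ (by positivity), one_mul]
    _ ≤ _ := by
        refine mul_le_mul_of_nonneg_left (Finset.sum_le_sum fun w hw => ?_) (by positivity)
        exact minFactor_le_fibreFactorNat Ψ hw

/-- **`β_p(Ψ) ≤ m_p (1 + t³/(p (p - t)))`**: generic residues contribute exactly `m_p`, the
`≤ t² p^{d-1}` non-generic ones at most `m_p (p-1)/(p-t)` each (`d ≥ 1`).
[cite: GreenTao2010, proof of Lemma 1.3] -/
theorem localFactor_le_minFactor_mul_add (hd : 1 ≤ d) (hL : ∀ i j, ((Ψ i).coeff j).natAbs ≤ L)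
    (ha : ∀ i, lastCoeff (Ψ i) ≠ 0) (hpL : 2 * L * L < p) (hpt : t < p) (ht : 1 ≤ t) :
    localFactor Ψ p ≤ minFactor Ψ p * (1 + (t : ℝ) ^ 3 / ((p : ℝ) * ((p : ℝ) - t))) := by
  classical
  have hL1 : 1 ≤ L := one_le_of_coeff_bound hL ha ht
  have hpL' : L < p := lt_of_le_of_lt (by nlinarith) hpL
  have hp0 : (0 : ℝ) < p := by exact_mod_cast hp.out.pos
  have hpt' : (t : ℝ) < p := by exact_mod_cast hpt
  have hm0 : 0 ≤ minFactor Ψ p := (minFactor_pos hL ha hpL' hpt).le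
  set B := Fintype.piFinset fun _ : Fin d => range p with hB
  set G : Finset (Fin d → ℕ) := B.filter fun w => (fun k => (w k : ℤ)) ∈ genericSet Ψ p with hG
  set NG : Finset (Fin d → ℕ) := B.filter fun w => ¬ (fun k => (w k : ℤ)) ∈ genericSet Ψ p with hNG
  have hcardB : #B = p ^ d := by
    rw [hB, Fintype.card_piFinset, Finset.prod_const, Finset.card_range, Finset.card_univ, Fintype.card_fin]
  have hcardNG : (#NG : ℝ) ≤ t * t * (p : ℝ) ^ (d - 1) := by
    have := card_not_mem_genericSet_le (Ψ := Ψ) (d := d) hL hpL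
    exact_mod_cast this
  -- split the average into generic and non-generic residues
  have hsplit : ∑ w ∈ B, fibreFactorNat Ψ p w =
      ∑ w ∈ G, fibreFactorNat Ψ p w + ∑ w ∈ NG, fibreFactorNat Ψ p w :=
    (Finset.sum_filter_add_sum_filter_not B _ _).symm
  have hG_eq : ∑ w ∈ G, fibreFactorNat Ψ p w = #G * minFactor Ψ p := by
    have hterm : ∀ w ∈ G, fibreFactorNat Ψ p w = minFactor Ψ p := fun w hw =>
      localFactor_eq_minFactor_of_mem_genericSet hL ha hpL' (Finset.mem_filter.mp hw).2
    rw [Finset.sum_congr rfl hterm, Finset.sum_const, nsmul_eq_mul]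
  have hNG_le : ∑ w ∈ NG, fibreFactorNat Ψ p w ≤ #NG * (minFactor Ψ p * (((p : ℝ) - 1) / ((p : ℝ) - t))) := by
    rw [← nsmul_eq_mul, ← Finset.sum_const]
    exact Finset.sum_le_sum fun w _ => localFactor_le_minFactor_mul hL ha hpL' hpt ht _
  have hGN : (#G : ℝ) + #NG = (p : ℝ) ^ d := by
    have := Finset.card_filter_add_card_filter_not (s := B) (fun w => (fun k => (w k : ℤ)) ∈ genericSet Ψ p)
    rw [← hG, ← hNG, hcardB] at this
    exact_mod_cast this
  rw [localFactor_eq_avg_fibre Ψ hp.out.ne_zero]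
  change ((p : ℝ) ^ d)⁻¹ * ∑ w ∈ B, fibreFactorNat Ψ p w ≤ _
  rw [hsplit, hG_eq]
  have hpd : (0 : ℝ) < (p : ℝ) ^ d := by positivity
  rw [inv_mul_le_iff₀ hpd]
  -- arithmetic: `#G m + #NG m (p-1)/(p-t) ≤ p^d m (1 + t³/(p(p-t)))`
  have hpt0 : (0 : ℝ) < (p : ℝ) - t := by linarith
  have hratio : ((p : ℝ) - 1) / ((p : ℝ) - t) = 1 + ((t : ℝ) - 1) / ((p : ℝ) - t) := by
    field_simp
    ring
  have key : (#NG : ℝ) * (((t : ℝ) - 1) / ((p : ℝ) - t)) ≤ (p : ℝ) ^ d * ((t : ℝ) ^ 3 / ((p : ℝ) * ((p : ℝ) - t))) := by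
    have ht1 : (0 : ℝ) ≤ (t : ℝ) - 1 := by
      have : (1 : ℝ) ≤ t := by exact_mod_cast ht
      linarith
    calc (#NG : ℝ) * (((t : ℝ) - 1) / ((p : ℝ) - t))
        ≤ (t * t * (p : ℝ) ^ (d - 1)) * (((t : ℝ) - 1) / ((p : ℝ) - t)) :=
          mul_le_mul_of_nonneg_right hcardNG (div_nonneg ht1 hpt0.le)
      _ ≤ (t * t * (p : ℝ) ^ (d - 1)) * ((t : ℝ) / ((p : ℝ) - t)) := by
          refine mul_le_mul_of_nonneg_left (div_le_div_of_nonneg_right (by linarith) hpt0.le) (by positivity)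
      _ = (p : ℝ) ^ (d - 1) * (p : ℝ) * ((t : ℝ) ^ 3 / ((p : ℝ) * ((p : ℝ) - t))) := by
          field_simp
      _ = (p : ℝ) ^ d * ((t : ℝ) ^ 3 / ((p : ℝ) * ((p : ℝ) - t))) := by
          rw [← pow_succ, Nat.sub_add_cancel hd]
  calc (#G : ℝ) * minFactor Ψ p + ∑ w ∈ NG, fibreFactorNat Ψ p w
      ≤ #G * minFactor Ψ p + #NG * (minFactor Ψ p * (((p : ℝ) - 1) / ((p : ℝ) - t))) := by linarith
    _ = minFactor Ψ p * ((#G + #NG) + #NG * (((t : ℝ) - 1) / ((p : ℝ) - t))) := by rw [hratio]; ring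
    _ = minFactor Ψ p * ((p : ℝ) ^ d + #NG * (((t : ℝ) - 1) / ((p : ℝ) - t))) := by rw [hGN]
    _ ≤ minFactor Ψ p * ((p : ℝ) ^ d + (p : ℝ) ^ d * ((t : ℝ) ^ 3 / ((p : ℝ) * ((p : ℝ) - t)))) := by
        gcongr
    _ = (p : ℝ) ^ d * (minFactor Ψ p * (1 + (t : ℝ) ^ 3 / ((p : ℝ) * ((p : ℝ) - t)))) := by ring

end LargePrime

end Summit.Parity.GeneralizedHardyLittlewood.Theorems
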